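import Mathlib
import HarnessLib

/-!
# PneNP / OverlapGapAlgebra — `SearchHardWindow`: occurrence-local rung, core counting lemmas

Support for crux `stmt-PneNP-2460` (`Summit.PneNP.PneNP.Theses.OverlapGapAlgebra.SearchHardWindow`).
This file is the combinatorial core of the OCCURRENCE-LOCAL RUNG (files
`OverlapGapAlgebraSearchHardWindowLocalRung{Core,Signs,}.lean`, prefix `shwL_`): every solver whose
output bit `x_v` is a function of the polarities of `v`'s own occurrences (with arbitrary dependence
on the variable pattern — majority / threshold votes, matched-formula decoders, …) solves
`F_k(n, ⌊αn⌋)` with probability `→ 0` for every `k` and every `α > 1`.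

Two self-contained counting tools, both folklore, stated without probability theory:

* `shwL_card_zero_mul_sum_le` — **second moment with a dependency relation** (Chebyshev /
  Cauchy–Schwarz in counting form). For events `B i ⊆ Ω`, `i ∈ I`, a relation `rel` with
  `#{i' ∈ I : rel i i'} ≤ D` and the product inequality `#(B i ∩ B i') · #Ω ≤ #(B i) · #(B i')` off
  `rel`: `#{ω : ω ∉ ⋃ B i} · Σ #(B i) ≤ #Ω² · D`, i.e. `Pr[X = 0] · E[X] ≤ D` for `X = Σ 1_{B i}`.
* `shwL_card_inter_mul_card` / `shwL_card_forall_mul_pow` — **independence of disjoint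
  coordinate blocks** on the cube `σ → Bool` by an explicit splice involution: an event determined
  by the coordinates in `T` and one determined by the coordinates outside `T` satisfy
  `#(E ∩ E') · #Ω = #E · #E'`; `k`-fold product and the lower-bound form
  `(∀ j, #Ω ≤ q · #(E j)) → #Ω ≤ q^{#J} · #(⋂ E j)`.

No definitions; all statements are decidable-instance generic (no classical instances baked in); axioms
`propext`, `Classical.choice`, `Quot.sound`.
-/

set_option linter.dupNamespace false -- `Summit.PneNP.PneNP.…`: summit = sub-problem (D-0017)

namespace Summit.PneNP.PneNP.Theorems

open Finset

section SecondMoment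

variable {Ω ι : Type*} [Fintype Ω] [DecidableEq Ω]

/-- Double counting: summing over points the number of events containing the point gives the
sum of the event sizes. -/
theorem shwL_sum_card_filter_mem (I : Finset ι) (B : ι → Finset Ω) :
    ∑ ω : Ω, (((I.filter fun i => ω ∈ B i).card : ℕ) : ℝ) = ∑ i ∈ I, ((B i).card : ℝ) := by
  have h : ∀ ω : Ω, (((I.filter fun i => ω ∈ B i).card : ℕ) : ℝ)
      = ∑ i ∈ I, (if ω ∈ B i then (1 : ℝ) else 0) := by
    intro ω
    rw [Finset.card_filter]
    push_cast
    rfl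
  simp_rw [h]
  rw [Finset.sum_comm]
  refine Finset.sum_congr rfl fun i _ => ?_
  rw [Finset.sum_boole]
  congr 2
  ext ω
  simp

/-- Double counting for the second moment: `Σ_ω X(ω)² = Σ_{i,i'} #(B i ∩ B i')` for
`X(ω) = #{i ∈ I : ω ∈ B i}`. -/
theorem shwL_sum_card_filter_mem_sq (I : Finset ι) (B : ι → Finset Ω) :
    ∑ ω : Ω, (((I.filter fun i => ω ∈ B i).card : ℕ) : ℝ) ^ 2
      = ∑ i ∈ I, ∑ i' ∈ I, (((B i ∩ B i').card : ℕ) : ℝ) := by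
  have h : ∀ ω : Ω, (((I.filter fun i => ω ∈ B i).card : ℕ) : ℝ)
      = ∑ i ∈ I, (if ω ∈ B i then (1 : ℝ) else 0) := by
    intro ω
    rw [Finset.card_filter]
    push_cast
    rfl
  have hB : ∀ i i' : ι, (((B i ∩ B i').card : ℕ) : ℝ)
      = ∑ ω : Ω, (if ω ∈ B i then (1 : ℝ) else 0) * (if ω ∈ B i' then (1 : ℝ) else 0) := by
    intro i i'
    have : ∀ ω : Ω, (if ω ∈ B i then (1 : ℝ) else 0) * (if ω ∈ B i' then (1 : ℝ) else 0)
        = if ω ∈ B i ∩ B i' then (1 : ℝ) else 0 := by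
      intro ω
      by_cases h1 : ω ∈ B i <;> by_cases h2 : ω ∈ B i' <;> simp [h1, h2]
    simp_rw [this]
    rw [Finset.sum_boole]
    congr 2
    ext ω
    simp
  simp_rw [h, hB, sq, Finset.sum_mul_sum]
  rw [Finset.sum_comm]
  refine Finset.sum_congr rfl fun i _ => ?_
  rw [Finset.sum_comm]

end SecondMoment

section SecondMomentMain

/-- **Second moment with a dependency relation (counting form).** Let `B i ⊆ Ω` (`i ∈ I`) be
events, `rel` a relation on indices such that every `i ∈ I` is related to at most `D` indices of
`I`, and such that unrelated pairs satisfy the product (independence, or negative correlation)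
inequality `#(B i ∩ B i') · #Ω ≤ #(B i) · #(B i')`. Then any set `Zs` of points avoiding every
event satisfies `#Zs · Σ_i #(B i) ≤ #Ω² · D` — in probabilistic terms `Pr[X = 0] · E[X] ≤ D` for
`X = Σ_i 1_{B i}`, the Chebyshev / second-moment inequality with the variance bounded through the
dependency relation. [folklore] -/
theorem shwL_card_zero_mul_sum_le {Ω ι : Type*} [Fintype Ω] [DecidableEq Ω]
    (I : Finset ι) (B : ι → Finset Ω) (rel : ι → ι → Prop)
    [DecidableRel rel] (D : ℕ) (hD : ∀ i ∈ I, (I.filter fun i' => rel i i').card ≤ D)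
    (hind : ∀ i ∈ I, ∀ i' ∈ I, ¬ rel i i' →
      (B i ∩ B i').card * Fintype.card Ω ≤ (B i).card * (B i').card)
    (Zs : Finset Ω) (hZs : ∀ ω ∈ Zs, ∀ i ∈ I, ω ∉ B i) :
    Zs.card * ∑ i ∈ I, (B i).card ≤ Fintype.card Ω ^ 2 * D := by
  -- it suffices to treat the full avoiding set
  suffices hfull : (univ.filter fun ω : Ω => ∀ i ∈ I, ω ∉ B i).card * ∑ i ∈ I, (B i).card
      ≤ Fintype.card Ω ^ 2 * D by
    refine le_trans (Nat.mul_le_mul_right _ (card_le_card fun ω hω => ?_)) hfull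
    exact mem_filter.2 ⟨mem_univ _, hZs ω hω⟩
  -- notation
  set X : Ω → ℝ := fun ω => (((I.filter fun i => ω ∈ B i).card : ℕ) : ℝ) with hX
  set s : ℝ := ∑ i ∈ I, ((B i).card : ℝ) with hs
  set N : ℝ := (Fintype.card Ω : ℝ) with hN
  set Zs : Finset Ω := univ.filter fun ω : Ω => ∀ i ∈ I, ω ∉ B i with hZs
  set Z : ℝ := (Zs.card : ℝ) with hZ
  set Q : ℝ := ∑ ω : Ω, X ω ^ 2 with hQ
  have hXnn : ∀ ω, 0 ≤ X ω := fun ω => Nat.cast_nonneg _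
  have hsum : ∑ ω : Ω, X ω = s := shwL_sum_card_filter_mem I B
  have hQeq : Q = ∑ i ∈ I, ∑ i' ∈ I, (((B i ∩ B i').card : ℕ) : ℝ) :=
    shwL_sum_card_filter_mem_sq I B
  have hs0 : 0 ≤ s := by rw [hs]; exact Finset.sum_nonneg fun i _ => Nat.cast_nonneg _
  have hN0 : 0 ≤ N := Nat.cast_nonneg _
  have hZ0 : 0 ≤ Z := Nat.cast_nonneg _
  have hD0 : (0 : ℝ) ≤ D := Nat.cast_nonneg _
  -- `X` vanishes exactly on `Zs`
  have hXzero : ∀ ω ∈ Zs, X ω = 0 := by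
    intro ω hω
    rw [hZs, mem_filter] at hω
    rw [hX]
    simp only [Nat.cast_eq_zero, card_eq_zero]
    ext i
    simp only [mem_filter, Finset.notMem_empty, iff_false, not_and]
    exact hω.2 i
  -- Cauchy–Schwarz on the support: `s² ≤ (N - Z) · Q`
  have hZle : Z ≤ N := by
    rw [hZ, hN]; exact_mod_cast card_le_univ _
  have hsupp : ((univ.filter fun ω : Ω => ¬ ∀ i ∈ I, ω ∉ B i).card : ℝ) = N - Z := by
    have h := Finset.card_filter_add_card_filter_not (s := (univ : Finset Ω))
      (fun ω : Ω => ∀ i ∈ I, ω ∉ B i)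
    rw [card_univ] at h
    rw [hN, hZ, hZs, ← h]
    push_cast
    ring
  have hCS : s ^ 2 ≤ (N - Z) * Q := by
    set P : Finset Ω := univ.filter fun ω : Ω => ¬ ∀ i ∈ I, ω ∉ B i with hP
    have hsP : s = ∑ ω ∈ P, X ω * 1 := by
      rw [← hsum]
      simp only [mul_one]
      symm
      refine Finset.sum_subset (subset_univ _) fun ω _ hω => hXzero ω ?_
      rw [hZs, mem_filter]
      rw [hP, mem_filter] at hω
      exact ⟨mem_univ _, by simpa using hω⟩
    have h1 := Finset.sum_mul_sq_le_sq_mul_sq P X (fun _ => (1 : ℝ))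
    have hQP : ∑ ω ∈ P, X ω ^ 2 ≤ Q :=
      Finset.sum_le_sum_of_subset_of_nonneg (subset_univ _) fun ω _ _ => sq_nonneg _
    have hone : ∑ _ω ∈ P, (1 : ℝ) ^ 2 = N - Z := by
      rw [← hsupp, hP]; simp
    rw [hsP]
    calc (∑ ω ∈ P, X ω * 1) ^ 2 ≤ (∑ ω ∈ P, X ω ^ 2) * ∑ _ω ∈ P, (1 : ℝ) ^ 2 := h1
      _ ≤ Q * (N - Z) := by
          rw [hone]
          exact mul_le_mul_of_nonneg_right hQP (by linarith)
      _ = (N - Z) * Q := by ring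
  -- covariance bound: `N · Q ≤ N · D · s + s²`
  have hcov : N * Q ≤ N * D * s + s ^ 2 := by
    rw [hQeq, Finset.mul_sum]
    have hrow : ∀ i ∈ I, N * ∑ i' ∈ I, (((B i ∩ B i').card : ℕ) : ℝ)
        ≤ N * D * ((B i).card : ℝ) + ((B i).card : ℝ) * s := by
      intro i hi
      rw [Finset.mul_sum, ← Finset.sum_filter_add_sum_filter_not I (fun i' => rel i i')]
      have hA : ∑ i' ∈ I.filter (fun i' => rel i i'), N * (((B i ∩ B i').card : ℕ) : ℝ)
          ≤ N * D * ((B i).card : ℝ) := by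
        calc ∑ i' ∈ I.filter (fun i' => rel i i'), N * (((B i ∩ B i').card : ℕ) : ℝ)
            ≤ ∑ _i' ∈ I.filter (fun i' => rel i i'), N * ((B i).card : ℝ) := by
              refine Finset.sum_le_sum fun i' _ => mul_le_mul_of_nonneg_left ?_ hN0
              exact_mod_cast card_le_card inter_subset_left
          _ = ((I.filter fun i' => rel i i').card : ℝ) * (N * ((B i).card : ℝ)) := by
              rw [sum_const, nsmul_eq_mul]
          _ ≤ (D : ℝ) * (N * ((B i).card : ℝ)) := by
              refine mul_le_mul_of_nonneg_right ?_ (by positivity)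
              exact_mod_cast hD i hi
          _ = N * D * ((B i).card : ℝ) := by ring
      have hB' : ∑ i' ∈ I.filter (fun i' => ¬ rel i i'), N * (((B i ∩ B i').card : ℕ) : ℝ)
          ≤ ((B i).card : ℝ) * s := by
        calc ∑ i' ∈ I.filter (fun i' => ¬ rel i i'), N * (((B i ∩ B i').card : ℕ) : ℝ)
            ≤ ∑ i' ∈ I.filter (fun i' => ¬ rel i i'), ((B i).card : ℝ) * ((B i').card : ℝ) := by
              refine Finset.sum_le_sum fun i' hi' => ?_
              rw [mem_filter] at hi'
              have := hind i hi i' hi'.1 hi'.2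
              rw [hN, mul_comm]
              exact_mod_cast this
          _ ≤ ∑ i' ∈ I, ((B i).card : ℝ) * ((B i').card : ℝ) :=
              Finset.sum_le_sum_of_subset_of_nonneg (filter_subset _ _)
                fun i' _ _ => by positivity
          _ = ((B i).card : ℝ) * s := by rw [hs, Finset.mul_sum]
      linarith
    calc ∑ i ∈ I, N * ∑ i' ∈ I, (((B i ∩ B i').card : ℕ) : ℝ)
        ≤ ∑ i ∈ I, (N * D * ((B i).card : ℝ) + ((B i).card : ℝ) * s) := Finset.sum_le_sum hrow
      _ = N * D * s + s ^ 2 := by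
          rw [Finset.sum_add_distrib, ← Finset.mul_sum, ← Finset.sum_mul, ← hs]; ring
  -- combine: `Z · s ≤ N² · D`
  have hmain : Z * s ≤ N ^ 2 * D := by
    have h1 : N * s ^ 2 ≤ (N - Z) * (N * D * s + s ^ 2) := by
      calc N * s ^ 2 ≤ N * ((N - Z) * Q) := mul_le_mul_of_nonneg_left hCS hN0
        _ = (N - Z) * (N * Q) := by ring
        _ ≤ (N - Z) * (N * D * s + s ^ 2) :=
            mul_le_mul_of_nonneg_left hcov (by linarith)
    -- `h1` rearranges to `Z · s · (N·D + s) ≤ N²·D·s`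
    have h2 : Z * s * (N * D + s) ≤ N ^ 2 * D * s := by nlinarith [h1]
    rcases hs0.eq_or_lt with h0 | hpos
    · rw [← h0, mul_zero]; positivity
    · have h3 : Z * (N * D + s) ≤ N ^ 2 * D := by
        have := h2
        rw [mul_assoc, mul_comm s, ← mul_assoc] at this
        exact le_of_mul_le_mul_right this hpos
      calc Z * s ≤ Z * (N * D + s) := by
            apply mul_le_mul_of_nonneg_left _ hZ0
            nlinarith
        _ ≤ N ^ 2 * D := h3
  -- cast back to `ℕ`
  have : ((univ.filter fun ω : Ω => ∀ i ∈ I, ω ∉ B i).card * ∑ i ∈ I, (B i).card : ℕ)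
      ≤ ((Fintype.card Ω ^ 2 * D : ℕ) : ℝ) := by
    push_cast
    rw [← hZs, ← hZ, ← hs, ← hN]
    exact hmain
  exact_mod_cast this

end SecondMomentMain

section Splice

variable {σ : Type*} [Fintype σ] [DecidableEq σ]

/-- **Independence of complementary coordinate blocks (counting form).** On the cube `σ → Bool`,
if membership in `E` depends only on the coordinates in `T` and membership in `E'` only on the
coordinates outside `T`, then `#(E ∩ E') · #(σ → Bool) = #E · #E'`. Proof: the splice involution
`(S, S') ↦ (S|_T ∪ S'|_{Tᶜ}, S'|_T ∪ S|_{Tᶜ})` is a bijection `(E ∩ E') × univ ≃ E × E'`.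
[folklore] -/
theorem shwL_card_inter_mul_card (T : Finset σ) (E E' : Finset (σ → Bool))
    (hE : ∀ S S' : σ → Bool, (∀ a ∈ T, S a = S' a) → (S ∈ E ↔ S' ∈ E))
    (hE' : ∀ S S' : σ → Bool, (∀ a ∉ T, S a = S' a) → (S ∈ E' ↔ S' ∈ E')) :
    (E ∩ E').card * Fintype.card (σ → Bool) = E.card * E'.card := by
  -- the splice map and its basic identities
  set sp : (σ → Bool) → (σ → Bool) → (σ → Bool) :=
    fun S S' a => if a ∈ T then S a else S' a with hsp
  have sp_on : ∀ S S' : σ → Bool, ∀ a ∈ T, sp S S' a = S a := by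
    intro S S' a ha; simp [hsp, ha]
  have sp_off : ∀ S S' : σ → Bool, ∀ a ∉ T, sp S S' a = S' a := by
    intro S S' a ha; simp [hsp, ha]
  have sp_sp : ∀ S S' : σ → Bool, sp (sp S S') (sp S' S) = S := by
    intro S S'
    funext a
    by_cases ha : a ∈ T <;> simp [hsp, ha]
  set Ψ : (σ → Bool) × (σ → Bool) → (σ → Bool) × (σ → Bool) :=
    fun p => (sp p.1 p.2, sp p.2 p.1) with hΨ
  have hΨΨ : ∀ p, Ψ (Ψ p) = p := by
    rintro ⟨S, S'⟩
    simp only [hΨ, sp_sp]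
  rw [← card_univ, ← card_product, ← card_product]
  refine card_nbij' Ψ Ψ ?_ ?_ (fun p _ => hΨΨ p) (fun p _ => hΨΨ p)
  · rintro ⟨S, S'⟩ hp
    simp only [coe_product, coe_inter, coe_univ, Set.mem_prod, Set.mem_inter_iff, mem_coe,
      Set.mem_univ, and_true] at hp
    simp only [hΨ, coe_product, Set.mem_prod, mem_coe]
    refine ⟨(hE S (sp S S') fun a ha => (sp_on S S' a ha).symm).1 hp.1,
      (hE' S (sp S' S) fun a ha => (sp_off S' S a ha).symm).1 hp.2⟩
  · rintro ⟨U, U'⟩ hq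
    simp only [coe_product, Set.mem_prod, mem_coe] at hq
    simp only [hΨ, coe_product, coe_inter, coe_univ, Set.mem_prod, Set.mem_inter_iff, mem_coe,
      Set.mem_univ, and_true]
    exact ⟨(hE U (sp U U') fun a ha => (sp_on U U' a ha).symm).1 hq.1,
      (hE' U' (sp U U') fun a ha => (sp_off U U' a ha).symm).1 hq.2⟩

/-- Variant of `shwL_card_inter_mul_card` with the second event determined by a block `T'`
disjoint from `T`. -/
theorem shwL_card_inter_mul_card_of_disjoint (T T' : Finset σ) (hTT' : Disjoint T T')
    (E E' : Finset (σ → Bool))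
    (hE : ∀ S S' : σ → Bool, (∀ a ∈ T, S a = S' a) → (S ∈ E ↔ S' ∈ E))
    (hE' : ∀ S S' : σ → Bool, (∀ a ∈ T', S a = S' a) → (S ∈ E' ↔ S' ∈ E')) :
    (E ∩ E').card * Fintype.card (σ → Bool) = E.card * E'.card :=
  shwL_card_inter_mul_card T E E' hE fun S S' h =>
    hE' S S' fun a ha => h a (Finset.disjoint_right.1 hTT' ha)

variable {κ : Type*} [DecidableEq κ]

/-- **`k`-fold independence of disjoint coordinate blocks (counting form).** If the events `E j`
(`j ∈ J`) are determined by pairwise disjoint coordinate blocks `T j` of the cube `σ → Bool`, then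
`#{S : ∀ j ∈ J, S ∈ E j} · #Ω^{#J} = (∏_{j ∈ J} #(E j)) · #Ω`. -/
theorem shwL_card_forall_mul_pow (J : Finset κ) (T : κ → Finset σ) (E : κ → Finset (σ → Bool))
    (hE : ∀ j ∈ J, ∀ S S' : σ → Bool, (∀ a ∈ T j, S a = S' a) → (S ∈ E j ↔ S' ∈ E j))
    (hT : ∀ j ∈ J, ∀ j' ∈ J, j ≠ j' → Disjoint (T j) (T j')) :
    (univ.filter fun S : σ → Bool => ∀ j ∈ J, S ∈ E j).card * Fintype.card (σ → Bool) ^ J.card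
      = (∏ j ∈ J, (E j).card) * Fintype.card (σ → Bool) := by
  induction J using Finset.induction_on with
  | empty => simp
  | @insert j₀ J hj₀ ih =>
    have hE_J : ∀ j ∈ J, ∀ S S' : σ → Bool, (∀ a ∈ T j, S a = S' a) → (S ∈ E j ↔ S' ∈ E j) :=
      fun j hj => hE j (mem_insert_of_mem hj)
    have hT_J : ∀ j ∈ J, ∀ j' ∈ J, j ≠ j' → Disjoint (T j) (T j') :=
      fun j hj j' hj' => hT j (mem_insert_of_mem hj) j' (mem_insert_of_mem hj')
    have ih' := ih hE_J hT_J
    set F : Finset (σ → Bool) := univ.filter fun S : σ → Bool => ∀ j ∈ J, S ∈ E j with hF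
    have hsplit : (univ.filter fun S : σ → Bool => ∀ j ∈ insert j₀ J, S ∈ E j) = E j₀ ∩ F := by
      ext S
      simp [hF]
    -- `F` is determined by the coordinates outside `T j₀`
    have hFdet : ∀ S S' : σ → Bool, (∀ a ∉ T j₀, S a = S' a) → (S ∈ F ↔ S' ∈ F) := by
      intro S S' h
      simp only [hF, mem_filter, mem_univ, true_and]
      refine forall₂_congr fun j hj => hE_J j hj S S' fun a ha => h a fun ha₀ => ?_
      have hne : j₀ ≠ j := fun heq => hj₀ (heq ▸ hj)
      exact Finset.disjoint_left.1 (hT j₀ (mem_insert_self _ _) j (mem_insert_of_mem hj) hne)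
        ha₀ ha
    have h2 := shwL_card_inter_mul_card (T j₀) (E j₀) F (hE j₀ (mem_insert_self _ _)) hFdet
    rw [hsplit, card_insert_of_notMem hj₀, prod_insert hj₀, pow_succ, ← mul_assoc,
      mul_comm ((E j₀ ∩ F).card) (Fintype.card (σ → Bool) ^ J.card)]
    calc Fintype.card (σ → Bool) ^ J.card * (E j₀ ∩ F).card * Fintype.card (σ → Bool)
        = Fintype.card (σ → Bool) ^ J.card * ((E j₀).card * F.card) := by rw [mul_assoc, h2]
      _ = (E j₀).card * (F.card * Fintype.card (σ → Bool) ^ J.card) := by ring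
      _ = (E j₀).card * ((∏ j ∈ J, (E j).card) * Fintype.card (σ → Bool)) := by rw [ih']
      _ = (E j₀).card * (∏ j ∈ J, (E j).card) * Fintype.card (σ → Bool) := by ring

/-- **Lower-bound form.** Under the hypotheses of `shwL_card_forall_mul_pow`, if every `E j` has
density at least `1/q` (`#Ω ≤ q · #(E j)`), then the intersection has density at least `q^{-#J}`:
`#Ω ≤ q^{#J} · #{S : ∀ j ∈ J, S ∈ E j}`. -/
theorem shwL_card_le_pow_mul_card_forall (J : Finset κ) (T : κ → Finset σ)
    (E : κ → Finset (σ → Bool))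
    (hE : ∀ j ∈ J, ∀ S S' : σ → Bool, (∀ a ∈ T j, S a = S' a) → (S ∈ E j ↔ S' ∈ E j))
    (hT : ∀ j ∈ J, ∀ j' ∈ J, j ≠ j' → Disjoint (T j) (T j')) (q : ℕ)
    (hq : ∀ j ∈ J, Fintype.card (σ → Bool) ≤ q * (E j).card) :
    Fintype.card (σ → Bool) ≤ q ^ J.card * (univ.filter fun S : σ → Bool => ∀ j ∈ J, S ∈ E j).card := by
  have hmain := shwL_card_forall_mul_pow J T E hE hT
  set N := Fintype.card (σ → Bool) with hN
  set F := (univ.filter fun S : σ → Bool => ∀ j ∈ J, S ∈ E j).card with hF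
  have hNpos : 0 < N := by rw [hN]; exact Fintype.card_pos
  have hprod : N ^ J.card ≤ q ^ J.card * ∏ j ∈ J, (E j).card := by
    calc N ^ J.card ≤ ∏ j ∈ J, (q * (E j).card) := Finset.pow_card_le_prod J _ N hq
      _ = q ^ J.card * ∏ j ∈ J, (E j).card := by rw [prod_mul_distrib, prod_const]
  have h : N * N ^ J.card ≤ (q ^ J.card * F) * N ^ J.card := by
    calc N * N ^ J.card ≤ N * (q ^ J.card * ∏ j ∈ J, (E j).card) := Nat.mul_le_mul_left _ hprod
      _ = q ^ J.card * ((∏ j ∈ J, (E j).card) * N) := by ring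
      _ = q ^ J.card * (F * N ^ J.card) := by rw [← hmain]
      _ = (q ^ J.card * F) * N ^ J.card := by ring
  exact Nat.le_of_mul_le_mul_right h (pow_pos hNpos _)

end Splice

end Summit.PneNP.PneNP.Theorems
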